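import Literature.RingTheory.Flat.UniversallyInjective
import Mathlib.Algebra.Module.LocalizedModule.Basic
import HarnessLib

/-!
# Universally injective maps localise

Topic: `Literature/RingTheory/Flat`. Stacks, Tag 05CM (1): let `A → B` be a ring map, `S ⊆ B` a
multiplicative subset and `f : M → M'` a map of `B`-modules which is universally injective as a
map of `A`-modules. Then the localised map `S⁻¹M → S⁻¹M'` is universally injective as a map of
`A`-modules. With universal injectivity defined by the equational criterion (Stacks, Tag 058K
(3), `UniversallyInjective.lean`) the proof is a clearing of denominators: relations
`f_S(ξᵢ) = ∑ aᵢⱼ ηⱼ` in `S⁻¹M'` come, after multiplying by a common denominator and by an element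
of `S` killing the resulting torsion, from relations `f(xᵢ) = ∑ aᵢⱼ yⱼ` in `M'`; solve these in
`M` and divide again. The statement is phrased for arbitrary localisations
(`IsLocalizedModule`). Used in the induction step of Raynaud–Gruson flattening (Stacks,
Tag 05I3: "the localization `α_𝔮` is `R`-universally injective, see 05CM").

* `IsUniversallyInjective.of_isLocalizedModule` — **Tag 05CM (1).**

## References

* The Stacks Project, Tag 05CM (Algebra, Lemma 10.82.13). [StacksProject]
-/

namespace Literature.RingTheory.Flat

open Function

variable {A B : Type*} [CommRing A] [CommRing B] [Algebra A B]
variable {M M' Mq M'q : Type*}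
  [AddCommGroup M] [Module B M] [Module A M] [IsScalarTower A B M]
  [AddCommGroup M'] [Module B M'] [Module A M'] [IsScalarTower A B M']
  [AddCommGroup Mq] [Module B Mq] [Module A Mq] [IsScalarTower A B Mq]
  [AddCommGroup M'q] [Module B M'q] [Module A M'q] [IsScalarTower A B M'q]

/-- A common denominator for finitely many elements of a localised module. [folklore] -/
theorem exists_common_denominator (S : Submonoid B) (mk : M →ₗ[B] Mq) [IsLocalizedModule S mk]
    {ι : Type*} [Fintype ι] (ξ : ι → Mq) :
    ∃ (s : S) (x : ι → M), ∀ i, (s : B) • ξ i = mk (x i) := by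
  classical
  choose p hp using fun i => IsLocalizedModule.surj S mk (ξ i)
  refine ⟨∏ i, (p i).2, fun i => (∏ i' ∈ Finset.univ.erase i, ((p i').2 : B)) • (p i).1,
    fun i => ?_⟩
  rw [map_smul, ← hp i, Submonoid.smul_def, smul_smul, Submonoid.coe_finsetProd,
    ← Finset.mul_prod_erase Finset.univ (fun i' => ((p i').2 : B)) (Finset.mem_univ i), mul_comm]

/-- **Stacks, Tag 05CM (1): universally injective maps localise.** For a ring map `A → B`, a
multiplicative subset `S ⊆ B`, `B`-linear localisations `M → S⁻¹M`, `M' → S⁻¹M'` and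
`B`-linear maps `f : M → M'`, `f_S : S⁻¹M → S⁻¹M'` compatible with them: if `f` is universally
injective as a map of `A`-modules then so is `f_S`. [cite: StacksProject, Tag 05CM] -/
theorem IsUniversallyInjective.of_isLocalizedModule (S : Submonoid B) (mk : M →ₗ[B] Mq)
    (mk' : M' →ₗ[B] M'q) [IsLocalizedModule S mk] [IsLocalizedModule S mk']
    {f : M →ₗ[B] M'} {fq : Mq →ₗ[B] M'q} (hc : fq ∘ₗ mk = mk' ∘ₗ f)
    (hf : IsUniversallyInjective (f.restrictScalars A)) :
    IsUniversallyInjective (fq.restrictScalars A) := by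
  classical
  intro ι κ _ _ ξ η a hrel
  -- common denominators for the `ξᵢ` and the `ηⱼ`
  obtain ⟨s, x, hx⟩ := exists_common_denominator S mk ξ
  obtain ⟨s', y, hy⟩ := exists_common_denominator S mk' η
  -- the relations in `M'` up to `S`-torsion: `mk' (s' f xᵢ - s ∑ aᵢⱼ yⱼ) = 0`
  have hrel₁ : ∀ i, mk' ((s' : B) • f (x i) - (s : B) • ∑ j, a i j • y j) = 0 := by
    intro i
    have h1 : mk' (f (x i)) = (s : B) • fq (ξ i) := by
      rw [← LinearMap.comp_apply, ← hc, LinearMap.comp_apply, ← hx i, map_smul]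
    have h2 : mk' (∑ j, a i j • y j) = (s' : B) • ∑ j, a i j • η j := by
      rw [map_sum, Finset.smul_sum]
      refine Finset.sum_congr rfl fun j _ => ?_
      rw [LinearMap.map_smul_of_tower, ← hy j, smul_comm]
    rw [map_sub, map_smul, map_smul, h1, h2, smul_smul, smul_smul, mul_comm (s' : B) (s : B)]
    change ((s : B) * (s' : B)) • (fq.restrictScalars A) (ξ i) - _ = 0
    rw [hrel i, sub_self]
  -- kill the torsion by a common `t ∈ S`
  have htor : ∀ i, ∃ t : S, (t : B) • ((s' : B) • f (x i) - (s : B) • ∑ j, a i j • y j) = 0 :=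
    fun i => (IsLocalizedModule.eq_zero_iff S mk').mp (hrel₁ i)
  choose t ht using htor
  set T : S := ∏ i, t i with hT
  have hT' : ∀ i, (T : B) • ((s' : B) • f (x i) - (s : B) • ∑ j, a i j • y j) = 0 := fun i => by
    rw [hT, Submonoid.coe_finsetProd,
      ← Finset.mul_prod_erase Finset.univ (fun i' => ((t i') : B)) (Finset.mem_univ i),
      mul_comm, ← smul_smul, ht i, smul_zero]
  -- honest relations `f (T s' xᵢ) = ∑ aᵢⱼ (T s yⱼ)` in `M'`, solved in `M`
  obtain ⟨z, hz⟩ := hf (fun i => ((T : B) * (s' : B)) • x i) (fun j => ((T : B) * (s : B)) • y j) a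
    (fun i => by
      change f (((T : B) * (s' : B)) • x i) = ∑ j, a i j • ((T : B) * (s : B)) • y j
      have h := hT' i
      rw [smul_sub, sub_eq_zero, smul_smul, smul_smul] at h
      rw [map_smul, h, Finset.smul_sum]
      refine Finset.sum_congr rfl fun j _ => ?_
      rw [smul_comm])
  -- divide by `T s s'`
  have hu : ∀ m : Mq, ∃ m' : Mq, (((T : B) * (s' : B) * (s : B)) : B) • m' = m := fun m =>
    ((Module.End.isUnit_iff _).mp
      (IsLocalizedModule.map_units mk ⟨(T : B) * (s' : B) * (s : B),
        S.mul_mem (S.mul_mem T.2 s'.2) s.2⟩)).surjective m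
  choose w hw using hu
  refine ⟨fun j => w (mk (z j)), fun i => ?_⟩
  apply IsLocalizedModule.smul_injective mk
    ⟨(T : B) * (s' : B) * (s : B), S.mul_mem (S.mul_mem T.2 s'.2) s.2⟩
  change ((T : B) * (s' : B) * (s : B)) • ξ i =
    ((T : B) * (s' : B) * (s : B)) • ∑ j, a i j • w (mk (z j))
  rw [Finset.smul_sum]
  calc ((T : B) * (s' : B) * (s : B)) • ξ i = ((T : B) * (s' : B)) • ((s : B) • ξ i) := by
        rw [smul_smul]
    _ = mk (((T : B) * (s' : B)) • x i) := by rw [hx i, map_smul]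
    _ = mk (∑ j, a i j • z j) := by rw [hz i]
    _ = ∑ j, a i j • mk (z j) := by
        rw [map_sum]
        simp_rw [LinearMap.map_smul_of_tower]
    _ = ∑ j, a i j • (((T : B) * (s' : B) * (s : B)) • w (mk (z j))) := by simp_rw [hw]
    _ = ∑ j, ((T : B) * (s' : B) * (s : B)) • a i j • w (mk (z j)) := by
        refine Finset.sum_congr rfl fun j _ => ?_
        rw [smul_comm]

end Literature.RingTheory.Flat
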